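/-
Copyright: cell `pub-ymgap` (HUMAN RULING D-0062), Track A of `YM-PLAN.md`, DAG node N20 (= NE7b); R134 acceleration seat
`pub-ymgap-dag-n20-c` (strategy s1, generation 5), module 31.  Released under the licence of the surrounding project.
-/
import Summits.QuantumFields.YangMills.Theorems.BalabanUVNodesN20LCSLabelTowerClassWeight
import HarnessLib

/-!
# YM-DAG node N20 (= NE7b), strategy s1, module 31: SUPPORT SEMANTICS OF THE LABEL TOWER's HISTORY TERMS — the (3.2) factor of the last label factors
# out of the label operation, so a level-`(k+1)` history term lives where the cubes of its label's new large-field family `P` are χ_{k+1}-LARGE and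
# every other (3.2)-range cube is χ_{k+1}-SMALL, and inside the small-field domain `χ_{k+1}(Ω_{k+1})` of its own (2.1)-sequence

Track A of `YM-PLAN.md` (cell `pub-ymgap`, HUMAN RULING D-0062), node **N20** = spine estimate NE7b (`T4WeightBudget.RelWeightBound` — NOT PRINTED,
NOT PROVED).  Seat `pub-ymgap-dag-n20-c` (R134, s1), generation 5, module 31 (after 27 = the label tower of record, 28 = the class weight bound on it,
29 = the by-value junction, 30 = keys rooted at a later step ⇐ «LCS-k»).  Kernel theorems only: 0 `def`, 0 `sorry`, standard axioms; COUNT-NEUTRAL;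
`--supports` the K3⁗ item.  Nothing of Bałaban's is asserted.

WHY.  Everything the (α)-road still owes at a later step is a statement about the STATE of a history term (`eterm ρ₀ (k+1) h` under `μ_{k+1}`): «LCS-(k+1)»
(module 30's `hLS`), n20-d's by-value carriers (`…N20LCSAvgByValue` §3: bounded BY VALUE where the pinned density lives, hypothesis `hsupp`), the key-pattern
READING («which regions does the history declare large ∕ small»).  For the label tower the answer is explicit: the label weight of record is
`ω s t (U,V′) = a(P)(V′)·b(P,Q)(U,V′)·ζ(R,S)(U,V′)` with the (3.2) factor `a(P)(V′) = [P ⊆ range]·Π_{□ ∈ range∖P} χ_{k+1}(□)(V′)·Π_{□ ∈ P}(1 − χ_{k+1}(□)(V′))`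
a function of the NEW field only — so it FACTORS OUT of the conditional expectation that defines the label operation.  THIS FILE records the consequences.

WHAT.
* §1 (the (3.2) factor, `{0,1}`-valued cube factors): `chiFactor_eq_zero_or_one`, ★ `aWeight_ne_zero` (`a(P)(V′) ≠ 0 ⇒ P ⊆ cubes32 s ∧ (∀ □ ∈ cubes32 s ∖ P,
  χ_{k+1}(□)(V′) = 1) ∧ (∀ □ ∈ P, χ_{k+1}(□)(V′) = 0)`), `aWeight_eq_one_of_ne_zero` (then `a(P)(V′) = 1`).
* §2 (factorisation, under the two ζ-laws and the (O4) measurability): ★★ `op_apply_eq_aWeight_mul` —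
  `(op k h q).T f V′ = a(P(q))(V′) · ∫ b·ζ·f d(condLaw μ_k avg_k V′)`; `eterm_succ_eq_aWeight_mul`.
* §3 (support): ★★★ **`aWeight_ne_zero_of_eterm_ne_zero`** and **`chiFactor_of_eterm_ne_zero`** — wherever a level-`(k+1)` history term of the label tower is
  non-zero, the last label's family `P` lies in the (3.2) range of the old sequence, its cubes are χ_{k+1}-LARGE (`χ = 0`) and all other range cubes are
  χ_{k+1}-SMALL (`χ = 1`) at that field; ★ **`chiSeq_eq_one_of_eterm_ne_zero`** — and the new front factor of record `χ_{k+1}(Ω_{k+1})` of the history's OWN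
  sequence `seqOfHist (k+1) h` equals `1` there (def-T's `front_absorb` ∕ module 17's `front_mul_ωOfRecord`: the (2.18) representation's «term lives in its
  small-field domain», ON THE OBJECT).
* §4 (the state): `eterm_succ_le_integral` (`0 ≤ eterm (k+1) h V′ ≤ ∫ eterm k h|_k dκ_{V′}` — the history term is dominated by the plain conditional
  expectation of its predecessor, the label weight being `≤ 1`).

HONEST FRAMING.  Reading lemmas; `χ_{k+1}(□)(V′) = 1` is def-R's characteristic function VALUE (by its typing convention `= 1` also off the solvable set of the
(2.16) problem — n20-d `…N20ChiSemantics`), NOT a plaquette-smallness assertion about `V′`; turning `χ = 1` into «plaquettes of `V′` small near `□`» is the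
regularity letter's business ([Balaban1985Variational] Thm 1, displayed as `hreg` in modules 18–30, not asserted).  Conditional-expectation currency (module 27).
NE7b NOT PRINTED ∕ NOT PROVED; (α)-instance 0∕1; N20 NOT discharged; typed 28∕28, discharged count untouched; one finite four-torus at fixed `ε` — NOT ℝ⁴, NOT
infinite volume, NOT OS, NOT a mass gap, NOT Clay.

References (LOCATORS): T. Bałaban, CMP 119 (1988) 243–285 [Balaban1988Convergent] ((2.17)–(2.18) p. 257, (3.2)–(3.5) p. 265, p. 267); CMP 122 (1989)
175–202 [Balaban1989LargeFieldI] ((1.22)–(1.28) pp. 181–183).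
-/

set_option autoImplicit false

noncomputable section

open scoped BigOperators

namespace Summit.QuantumFields.YangMills.BalabanUVNodes.N20LCSLabelTowerSupport

open MeasureTheory
open Literature.MathematicalPhysics.QuantumFieldTheory.Balaban1983to89
open Literature.MathematicalPhysics.QuantumFieldTheory.Balaban1983to89.T4Continuum
open Literature.MathematicalPhysics.QuantumFieldTheory.Balaban1983to89.T4AveragingDisintegration (condLaw)
open Literature.MathematicalPhysics.QuantumFieldTheory.Balaban1983to89.Node00
open Summit.QuantumFields.BalabanUV.T4Continuum.B16HistoryIndexedRepr (GoodClass)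
open Summit.QuantumFields.BalabanUV.T4Continuum.B16HistoryReprChain
open Summit.QuantumFields.YangMills.BalabanUVNodes.N20LCSLabelTower
open Summit.QuantumFields.YangMills.BalabanUVNodes.N20LCSLabelTowerClassWeight (clampW_ωOfRecord)
open Summit.QuantumFields.YangMills.BalabanUVNodes.N20LCSLargeFieldLabels (aWeight_eq front_mul_ωOfRecord)
open Summit.QuantumFields.YangMills.BalabanUVNodes.N20LCSLargeFieldSubfamilies (ωOfRecord_nonneg)
open Summit.QuantumFields.YangMills.BalabanUVNodes.N20LCSLargeFieldSparsify (zeta_nonneg_of_laws)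

variable (F : T4Family) (N : ℕ) [NeZero N] (ν : Stage7Numerics) (M : ℕ) (p : B12.RunParams) (g : ℕ → ℝ)

/-! ## §1 The (3.2) factor: where it does not vanish, the label's cubes are large and the other range cubes small -/

section Factor

variable (k : ℕ)

/-- The χ_{k+1}-cube factor of record takes the values `0` and `1` only (`chiFactor_mul_self`). [folklore] -/
theorem chiFactor_eq_zero_or_one (c : Iχ F ν p g k) (V' : GaugeField (F.P p.K) (k + 1) (SU N)) :
    chiFactor F N ν p g k c V' = 0 ∨ chiFactor F N ν p g k c V' = 1 := by
  have h := chiFactor_mul_self F N ν p g k c V'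
  have h' : chiFactor F N ν p g k c V' * (chiFactor F N ν p g k c V' - 1) = 0 := by rw [mul_sub, mul_one, h, sub_self]
  rcases mul_eq_zero.1 h' with h0 | h1
  · exact Or.inl h0
  · exact Or.inr (sub_eq_zero.1 h1)

open Classical in
/-- ★ **WHERE THE (3.2) FACTOR DOES NOT VANISH**: `a(P)(V′) ≠ 0` forces `P ⊆ (3.2)-range`, every range cube OUTSIDE `P` χ_{k+1}-small at `V′`
(`χ(□)(V′) = 1`) and every cube IN `P` χ_{k+1}-large (`χ(□)(V′) = 0`). [folklore] -/
theorem aWeight_ne_zero (s : SeqOfRecord F ν M g p.K k) (Pl : Finset (Iχ F ν p g k)) (V' : GaugeField (F.P p.K) (k + 1) (SU N))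
    (h : aWeight F N ν M p g k s Pl V' ≠ 0) :
    Pl ⊆ cubes32 F ν M p g k s ∧ (∀ c ∈ cubes32 F ν M p g k s \ Pl, chiFactor F N ν p g k c V' = 1) ∧
      (∀ c ∈ Pl, chiFactor F N ν p g k c V' = 0) := by
  rw [aWeight_eq] at h
  by_cases hsub : Pl ⊆ cubes32 F ν M p g k s
  · rw [if_pos hsub] at h
    obtain ⟨h1, h2⟩ := mul_ne_zero_iff.1 h
    refine ⟨hsub, fun c hc => ?_, fun c hc => ?_⟩
    · rcases chiFactor_eq_zero_or_one F N ν p g k c V' with h0 | h1'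
      · exact absurd (Finset.prod_eq_zero hc h0) h1
      · exact h1'
    · rcases chiFactor_eq_zero_or_one F N ν p g k c V' with h0 | h1'
      · exact h0
      · exact absurd (Finset.prod_eq_zero hc (by rw [h1', sub_self])) h2
  · exact absurd (if_neg hsub) (fun e => h (by rw [e]))

open Classical in
/-- … and then the (3.2) factor equals `1` (a product of ones). [folklore] -/
theorem aWeight_eq_one_of_ne_zero (s : SeqOfRecord F ν M g p.K k) (Pl : Finset (Iχ F ν p g k)) (V' : GaugeField (F.P p.K) (k + 1) (SU N))
    (h : aWeight F N ν M p g k s Pl V' ≠ 0) : aWeight F N ν M p g k s Pl V' = 1 := by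
  obtain ⟨hsub, hout, hin⟩ := aWeight_ne_zero F N ν M p g k s Pl V' h
  rw [aWeight_eq, if_pos hsub, Finset.prod_eq_one fun c hc => hout c hc, Finset.prod_eq_one fun c hc => by rw [hin c hc, sub_zero], one_mul]

end Factor

/-! ## §2 The (3.2) factor factors out of the label operation -/

section Factorisation

variable {A₁ : ℝ} {ζ : ZetaOfRecord F N ν M}

/-- ★★ **THE (3.2) FACTOR FACTORS OUT OF THE LABEL OPERATION**: under the two ζ-laws and the (O4) measurability, for every `f`,
`(op k h q).T f V′ = a(P(q))(V′) · ∫ b(P,Q)(U,V′)·ζ(R,S)(U,V′)·f(U) condLaw(V′, dU)` — the label operation is the (3.2) factor at the new field times a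
conditional expectation weighted by the (3.3) and residual factors. [folklore] -/
theorem op_apply_eq_aWeight_mul (A₁ : ℝ) (hζu : IsZetaUnity F N ν M ζ) (hζ : IsZetaAbsLeOne F N ν M ζ)
    (hω : ∀ (k : ℕ) (s : SeqOfRecord F ν M g p.K k) (t : LbOfRecord F ν p g k),
      Measurable fun z : cfgOfRecord F N p.K (k + 1) × cfgOfRecord F N p.K k => ωOfRecord F N ν M p g k A₁ ζ s t z.2 z.1)
    (k : ℕ) (h : Fin k → LabelPat F ν p g) (q : LabelPat F ν p g) (f : cfgOfRecord F N p.K k → ℝ) (V' : cfgOfRecord F N p.K (k + 1)) :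
    ((labelTowerOfRecord F N ν M p g A₁ ζ).op k h q).T f V' =
      aWeight F N ν M p g k (seqOfHist F ν M p g k h) (labelAt F ν p g k q).1 V' *
        ∫ U, bWeight F N ν M p g k A₁ (seqOfHist F ν M p g k h) (labelAt F ν p g k q).1 (labelAt F ν p g k q).2.1 U V' *
            ζ p g k (seqOfHist F ν M p g k h) (labelAt F ν p g k q).1 (labelAt F ν p g k q).2.1 (labelAt F ν p g k q).2.2 U V' * f U
          ∂(condLaw (lawOfRecord F N p.K k) (avOfRecord F N p.K k).avg V') := by
  rw [op_apply_eq_integral_condLaw F N ν M p g hω, ← integral_const_mul]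
  refine integral_congr_ae (ae_of_all _ fun U => ?_)
  dsimp only
  rw [clampW_ωOfRecord F N ν M p g A₁ hζu hζ, ωOfRecord]
  ring

/-- The same for the history term one step up: `eterm (k+1) h V′ = a(P(h_k))(V′) · ∫ b·ζ·eterm k h|_k dκ_{V′}`. [folklore] -/
theorem eterm_succ_eq_aWeight_mul (A₁ : ℝ) (hζu : IsZetaUnity F N ν M ζ) (hζ : IsZetaAbsLeOne F N ν M ζ)
    (hω : ∀ (k : ℕ) (s : SeqOfRecord F ν M g p.K k) (t : LbOfRecord F ν p g k),
      Measurable fun z : cfgOfRecord F N p.K (k + 1) × cfgOfRecord F N p.K k => ωOfRecord F N ν M p g k A₁ ζ s t z.2 z.1)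
    (ρ₀ : cfgOfRecord F N p.K 0 → ℝ) (k : ℕ) (h : Fin (k + 1) → LabelPat F ν p g) (V' : cfgOfRecord F N p.K (k + 1)) :
    (labelTowerOfRecord F N ν M p g A₁ ζ).eterm ρ₀ (k + 1) h V' =
      aWeight F N ν M p g k (seqOfHist F ν M p g k (Fin.init h)) (labelAt F ν p g k (h (Fin.last k))).1 V' *
        ∫ U, bWeight F N ν M p g k A₁ (seqOfHist F ν M p g k (Fin.init h)) (labelAt F ν p g k (h (Fin.last k))).1
              (labelAt F ν p g k (h (Fin.last k))).2.1 U V' *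
            ζ p g k (seqOfHist F ν M p g k (Fin.init h)) (labelAt F ν p g k (h (Fin.last k))).1 (labelAt F ν p g k (h (Fin.last k))).2.1
              (labelAt F ν p g k (h (Fin.last k))).2.2 U V' *
            (labelTowerOfRecord F N ν M p g A₁ ζ).eterm ρ₀ k (Fin.init h) U
          ∂(condLaw (lawOfRecord F N p.K k) (avOfRecord F N p.K k).avg V') :=
  op_apply_eq_aWeight_mul F N ν M p g A₁ hζu hζ hω k (Fin.init h) (h (Fin.last k)) _ V'

end Factorisation

/-! ## §3 Support: a history term lives where its last label's cubes are large and the rest of the range is small -/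

section Support

variable {A₁ : ℝ} {ζ : ZetaOfRecord F N ν M}

/-- ★★★ **THE (3.2) FACTOR OF THE LAST LABEL DOES NOT VANISH ON THE SUPPORT OF THE HISTORY TERM.** [folklore] -/
theorem aWeight_ne_zero_of_eterm_ne_zero (A₁ : ℝ) (hζu : IsZetaUnity F N ν M ζ) (hζ : IsZetaAbsLeOne F N ν M ζ)
    (hω : ∀ (k : ℕ) (s : SeqOfRecord F ν M g p.K k) (t : LbOfRecord F ν p g k),
      Measurable fun z : cfgOfRecord F N p.K (k + 1) × cfgOfRecord F N p.K k => ωOfRecord F N ν M p g k A₁ ζ s t z.2 z.1)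
    (ρ₀ : cfgOfRecord F N p.K 0 → ℝ) (k : ℕ) (h : Fin (k + 1) → LabelPat F ν p g) (V' : cfgOfRecord F N p.K (k + 1))
    (hne : (labelTowerOfRecord F N ν M p g A₁ ζ).eterm ρ₀ (k + 1) h V' ≠ 0) :
    aWeight F N ν M p g k (seqOfHist F ν M p g k (Fin.init h)) (labelAt F ν p g k (h (Fin.last k))).1 V' ≠ 0 := by
  rw [eterm_succ_eq_aWeight_mul F N ν M p g A₁ hζu hζ hω ρ₀ k h V'] at hne
  exact (mul_ne_zero_iff.1 hne).1

open Classical in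
/-- ★★★ **WHERE A HISTORY TERM LIVES, ITS LAST LABEL's NEW LARGE-FIELD FAMILY IS χ-LARGE AND THE REST OF THE (3.2) RANGE IS χ-SMALL.**  Under the two
ζ-laws and the (O4) measurability: if `eterm ρ₀ (k+1) h V′ ≠ 0` and the last label of `h` is `t = (P,Q,R,S)`, then `P ⊆ cubes32 (seqOfHist k h|_k)`, every
range cube outside `P` has `χ_{k+1}(□)(V′) = 1` and every cube in `P` has `χ_{k+1}(□)(V′) = 0`. [folklore] -/
theorem chiFactor_of_eterm_ne_zero (A₁ : ℝ) (hζu : IsZetaUnity F N ν M ζ) (hζ : IsZetaAbsLeOne F N ν M ζ)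
    (hω : ∀ (k : ℕ) (s : SeqOfRecord F ν M g p.K k) (t : LbOfRecord F ν p g k),
      Measurable fun z : cfgOfRecord F N p.K (k + 1) × cfgOfRecord F N p.K k => ωOfRecord F N ν M p g k A₁ ζ s t z.2 z.1)
    (ρ₀ : cfgOfRecord F N p.K 0 → ℝ) (k : ℕ) (h : Fin (k + 1) → LabelPat F ν p g) (V' : cfgOfRecord F N p.K (k + 1))
    (hne : (labelTowerOfRecord F N ν M p g A₁ ζ).eterm ρ₀ (k + 1) h V' ≠ 0) :
    (labelAt F ν p g k (h (Fin.last k))).1 ⊆ cubes32 F ν M p g k (seqOfHist F ν M p g k (Fin.init h)) ∧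
      (∀ c ∈ cubes32 F ν M p g k (seqOfHist F ν M p g k (Fin.init h)) \ (labelAt F ν p g k (h (Fin.last k))).1,
        chiFactor F N ν p g k c V' = 1) ∧
      (∀ c ∈ (labelAt F ν p g k (h (Fin.last k))).1, chiFactor F N ν p g k c V' = 0) :=
  aWeight_ne_zero F N ν M p g k _ _ V' (aWeight_ne_zero_of_eterm_ne_zero F N ν M p g A₁ hζu hζ hω ρ₀ k h V' hne)

/-- ★ **THE HISTORY TERM LIVES IN ITS OWN SMALL-FIELD DOMAIN**: under the (O4) measurability (no ζ-law needed), wherever `eterm ρ₀ (k+1) h V′ ≠ 0` the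
new front factor of record `χ_{k+1}(Ω_{k+1})` of the history's (2.1)-sequence `seqOfHist (k+1) h` equals `1` — def-T's `front_absorb` read on the object:
the label piece of (2.18)'s `Σ_s χ_{k+1}(s)·T(s)` carries its characteristic function. [folklore] -/
theorem chiSeq_eq_one_of_eterm_ne_zero
    (hω : ∀ (k : ℕ) (s : SeqOfRecord F ν M g p.K k) (t : LbOfRecord F ν p g k),
      Measurable fun z : cfgOfRecord F N p.K (k + 1) × cfgOfRecord F N p.K k => ωOfRecord F N ν M p g k A₁ ζ s t z.2 z.1)
    (ρ₀ : cfgOfRecord F N p.K 0 → ℝ) (k : ℕ) (h : Fin (k + 1) → LabelPat F ν p g) (V' : cfgOfRecord F N p.K (k + 1))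
    (hne : (labelTowerOfRecord F N ν M p g A₁ ζ).eterm ρ₀ (k + 1) h V' ≠ 0) :
    chiSeqOfRecord F N ν M g p.K (k + 1) (seqOfHist F ν M p g (k + 1) h) V' = 1 := by
  -- the history term is a conditional expectation of `clampW ω · eterm_k`; where it is non-zero some `ω (U, V′) ≠ 0`, and `χ_{k+1}·ω = ω` pins `χ_{k+1} = 1`
  have happ : (labelTowerOfRecord F N ν M p g A₁ ζ).eterm ρ₀ (k + 1) h V' =
      ∫ U, clampW (ωOfRecord F N ν M p g k A₁ ζ (seqOfHist F ν M p g k (Fin.init h)) (labelAt F ν p g k (h (Fin.last k))) U V') *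
        (labelTowerOfRecord F N ν M p g A₁ ζ).eterm ρ₀ k (Fin.init h) U ∂(condLaw (lawOfRecord F N p.K k) (avOfRecord F N p.K k).avg V') :=
    op_apply_eq_integral_condLaw F N ν M p g hω k (Fin.init h) (h (Fin.last k)) _ V'
  rw [happ] at hne
  -- if `ω (U, V′) = 0` for every `U` the integral vanishes
  by_contra hχ
  apply hne
  refine integral_eq_zero_of_ae (ae_of_all _ fun U => ?_)
  have hzero : ωOfRecord F N ν M p g k A₁ ζ (seqOfHist F ν M p g k (Fin.init h)) (labelAt F ν p g k (h (Fin.last k))) U V' = 0 := by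
    have hfront := front_mul_ωOfRecord F N ν M p g k A₁ ζ (seqOfHist F ν M p g k (Fin.init h)) (labelAt F ν p g k (h (Fin.last k))) U V'
    -- the front factor is `{0,1}`-valued: if it is not `1` then `ω = χ·ω` forces `ω = 0`
    by_contra hω0
    apply hχ
    have := mul_left_eq_self₀.1 hfront
    rcases this with h1 | h0
    · exact h1
    · exact absurd h0 hω0
  show clampW _ * _ = 0
  rw [hzero, clampW, min_eq_right (zero_le_one : (0:ℝ) ≤ 1), max_self, zero_mul]

end Support

/-! ## §4 The state one step up is dominated by the plain conditional expectation of its predecessor -/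

section State

variable {A₁ : ℝ} {ζ : ZetaOfRecord F N ν M}

/-- `0 ≤ eterm (k+1) h V′ ≤ ∫ eterm k h|_k dκ_{V′}`: the label weight lies in `[0,1]` (clamped), so the history term is non-negative and at most the
un-weighted conditional expectation of its predecessor (any `ρ₀ ≥ 0` in the good class; (O4) for the unfolding). [folklore] -/
theorem eterm_succ_le_integral
    (hω : ∀ (k : ℕ) (s : SeqOfRecord F ν M g p.K k) (t : LbOfRecord F ν p g k),
      Measurable fun z : cfgOfRecord F N p.K (k + 1) × cfgOfRecord F N p.K k => ωOfRecord F N ν M p g k A₁ ζ s t z.2 z.1)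
    {ρ₀ : cfgOfRecord F N p.K 0 → ℝ} (hρ : (bddMeas (cfgOfRecord F N p.K 0)).Gd ρ₀) (h0 : ∀ U, 0 ≤ ρ₀ U) (k : ℕ)
    (h : Fin (k + 1) → LabelPat F ν p g) (V' : cfgOfRecord F N p.K (k + 1)) :
    0 ≤ (labelTowerOfRecord F N ν M p g A₁ ζ).eterm ρ₀ (k + 1) h V' ∧
      (labelTowerOfRecord F N ν M p g A₁ ζ).eterm ρ₀ (k + 1) h V' ≤
        ∫ U, (labelTowerOfRecord F N ν M p g A₁ ζ).eterm ρ₀ k (Fin.init h) U ∂(condLaw (lawOfRecord F N p.K k) (avOfRecord F N p.K k).avg V') := by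
  refine ⟨(labelTowerOfRecord F N ν M p g A₁ ζ).eterm_nonneg hρ h0 (k + 1) h V', ?_⟩
  have happ : (labelTowerOfRecord F N ν M p g A₁ ζ).eterm ρ₀ (k + 1) h V' =
      ∫ U, clampW (ωOfRecord F N ν M p g k A₁ ζ (seqOfHist F ν M p g k (Fin.init h)) (labelAt F ν p g k (h (Fin.last k))) U V') *
        (labelTowerOfRecord F N ν M p g A₁ ζ).eterm ρ₀ k (Fin.init h) U ∂(condLaw (lawOfRecord F N p.K k) (avOfRecord F N p.K k).avg V') :=
    op_apply_eq_integral_condLaw F N ν M p g hω k (Fin.init h) (h (Fin.last k)) _ V'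
  rw [happ]
  have hek : (bddMeas (cfgOfRecord F N p.K k)).Gd ((labelTowerOfRecord F N ν M p g A₁ ζ).eterm ρ₀ k (Fin.init h)) :=
    (labelTowerOfRecord F N ν M p g A₁ ζ).eterm_good hρ k (Fin.init h)
  have hint : Integrable ((labelTowerOfRecord F N ν M p g A₁ ζ).eterm ρ₀ k (Fin.init h))
      (condLaw (lawOfRecord F N p.K k) (avOfRecord F N p.K k).avg V') := integrable_of_bddMeas _ hek
  refine integral_mono_of_nonneg (ae_of_all _ fun U => mul_nonneg (clampW_nonneg _)
      ((labelTowerOfRecord F N ν M p g A₁ ζ).eterm_nonneg hρ h0 k (Fin.init h) U)) hint (ae_of_all _ fun U => ?_)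
  exact mul_le_of_le_one_left ((labelTowerOfRecord F N ν M p g A₁ ζ).eterm_nonneg hρ h0 k (Fin.init h) U) (clampW_le_one _)

end State

end Summit.QuantumFields.YangMills.BalabanUVNodes.N20LCSLabelTowerSupport

end
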